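import Literature.Analysis.OperatorTheory.SchurTestKernel

/-!
# The IMS localisation formula for integral kernels (transfer-operator / non-local form), PROVED

Sources.
* E. H. Lieb, H.-T. Yau, *The stability and instability of relativistic matter*, Commun. Math. Phys. **118**
  (1988) 177–213, §III Step B, **Theorem 9 (Localization of kinetic energy — general form)**, eqs. (3.6)–(3.7)
  [held: `paper:doi-10-1007-3-540-27056-6-34` (Selecta reprint), p0015]: for real Lipschitz `χ_0, …, χ_K` with
  `Σ_j χ_j(x)² = 1` (3.2) and `f ∈ L²(ℝ³)`:  `(f, |p| f) = Σ_j (χ_j f, |p| χ_j f) − (f, L f)` (3.6), where `L` is the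
  bounded operator with KERNEL `L(x,y) = (2π²)⁻¹ |x − y|⁻⁴ · Σ_j [χ_j(x) − χ_j(y)]²` (3.7); the proof there
  ("immediate starting with (2.9) and (2.12)") is the pointwise computation below, applied to the positive kernel
  of the semigroup `e^{−t|p|}` ((2.10)–(2.11): `(f,|p|f) = lim_{t↓0} t⁻¹ {(f,f) − (f, e^{−t|p|} f)}`).
* The same computation for the LOCAL operator `−Δ` is the IMS (Ismagilov–Morgan–Simon–Sigal) localisation formula
  `Σ_j J_j H J_j = H + Σ_j |∇J_j|²`, loc. cit. (3.3) (from Cycon–Froese–Kirsch–Simon, Thm. 3.2).  The finite MATRIX form,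
  with the Schur bound on the error, is already in the tree:
  `Literature.MathematicalPhysics.QuantumFieldTheory.Balaban1983to89.B9SectEKernel.ims_localization` / `ims_lower`.

This file is the MEASURE-SPACE KERNEL form between the two — what one needs to localise the quadratic form
`∫∫ ψ(x) K(x,y) ψ(y) dμ dμ` of a TRANSFER OPERATOR (a kernel on a probability space; e.g. the tree's `qform` in
`Summits/QuantumFields/YangMills/Theorems/FemtoTransferGap.lean`, which has exactly the iterated-integral shape used
here) with a quadratic partition of unity `Σ_s χ_s² = 1`, and to control the localisation error by Schur's test
(`Literature.Analysis.OperatorTheory.SchurTestKernel`).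

What is proved (finite index type `ι`; real kernel `K` on a measure space `(X, μ)`, `μ` s-finite; real
`χ : ι → X → ℝ` with `Σ_s χ_s(x)² = 1` for all `x`, each `χ_s` measurable; real `f`, `g`):

* `sum_mul_eq_one_sub_half_sum_sq_sub` — the pointwise identity `Σ_s χ_s(x) χ_s(y) = 1 − ½ Σ_s (χ_s(x) − χ_s(y))²`,
  and `sum_localized_integrand` — its consequence for the integrand;
* `ims_localization` — **the kernel IMS formula** (bilinear form; only joint integrability of `f ⊗ K ⊗ g` is assumed,
  every other integrand being dominated by it):
  `Σ_s ∫∫ (χ_s f)(x) K(x,y) (χ_s g)(y) = ∫∫ f(x) K(x,y) g(y) − ½ ∫∫ f(x) · K(x,y)[Σ_s (χ_s(x) − χ_s(y))²] · g(y)`;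
* `sum_integral_localized_sq` — `Σ_s ∫ (χ_s f)² = ∫ f²`;
* `abs_integral_imsError_le` — **Schur bound on the localisation error**: if the error kernel
  `|K(x,y)| · Σ_s (χ_s(x) − χ_s(y))²` has row integrals and column integrals `≤ ε` (a.e.), then
  `|∫∫ f(x) K(x,y)[Σ_s (χ_s(x) − χ_s(y))²] f(y)| ≤ ε ∫ f²`;
* `abs_sub_sum_localized_le` — hence `|∫∫ f K f − Σ_s ∫∫ (χ_s f) K (χ_s f)| ≤ (ε/2) ∫ f²`;
* `le_of_localized_le` / `le_const_mul_of_localized_le` — **transfer of local bounds** (the use of the formula):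
  local bounds `∫∫ (χ_s f) K (χ_s f) ≤ m_s ∫ (χ_s f)²` give
  `∫∫ f K f ≤ ∫ (Σ_s m_s χ_s²) f² + (ε/2) ∫ f² ≤ (M + ε/2) ∫ f²` (`m_s ≤ M`);
* `ims_lower` / `ims_lower_const` — the same for ENERGY forms `c ∫f² − ∫∫ f K f` (lower bounds proved piece by
  piece transfer to the whole space at the price `ε/2`), the literal analogue of `B9SectEKernel.ims_lower`;
* `const_mul_integral_sq_sub_eq_half` — the **Dirichlet-form identity** behind Lieb–Yau's (2.9)–(2.11)
  (`(f,f) − (f, P_t f) = ½∫∫ P_t(x,y)|f(x) − f(y)|²`): for a SYMMETRIC kernel with constant row integrals `c`,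
  `c ∫ f² − ∫∫ f K f = ½ ∫∫ K(x,y) (f(x) − f(y))²` — the energy form of a transfer kernel as a jump Dirichlet form
  (lower bounds on `⟨f, K f⟩` = upper bounds on `½∫∫K(f(x)−f(y))²`, e.g. by Taylor expansion of `f`).

No definitions, no named facts, 0 sorry.
-/

noncomputable section

open MeasureTheory

namespace Literature.Analysis.OperatorTheory.KernelIMS

/-! ## 1. The pointwise identities of a quadratic partition of unity -/

section Algebra

variable {α ι : Type*} [Fintype ι]

/-- For a quadratic partition of unity `Σ_s χ_s² = 1`:  `Σ_s χ_s(x) χ_s(y) = 1 − ½ Σ_s (χ_s(x) − χ_s(y))²` — the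
one-line computation behind every form of the IMS localisation formula. [cite: LiebYau1988, Thm 9 (proof), (3.2)] -/
theorem sum_mul_eq_one_sub_half_sum_sq_sub (χ : ι → α → ℝ) (hpart : ∀ x, ∑ s, χ s x ^ 2 = 1) (x y : α) :
    ∑ s, χ s x * χ s y = 1 - (1 / 2) * ∑ s, (χ s x - χ s y) ^ 2 := by
  have e : ∀ s, (χ s x - χ s y) ^ 2 = (χ s x ^ 2 + χ s y ^ 2) - 2 * (χ s x * χ s y) := fun s => by ring
  simp_rw [e]
  rw [Finset.sum_sub_distrib, Finset.sum_add_distrib, ← Finset.mul_sum, hpart, hpart]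
  ring

/-- `Σ_s (χ_s(x) − χ_s(y))² ≥ 0`. [cite: LiebYau1988, Thm 9, (3.7)] -/
theorem sum_sq_sub_nonneg (χ : ι → α → ℝ) (x y : α) : 0 ≤ ∑ s, (χ s x - χ s y) ^ 2 :=
  Finset.sum_nonneg fun _ _ => sq_nonneg _

/-- `Σ_s (χ_s(x) − χ_s(y))² ≤ 4` for a quadratic partition of unity (crudely: `(a − b)² ≤ 2a² + 2b²`).
[cite: LiebYau1988, Thm 9, (3.2)/(3.7)] -/
theorem sum_sq_sub_le_four (χ : ι → α → ℝ) (hpart : ∀ x, ∑ s, χ s x ^ 2 = 1) (x y : α) :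
    ∑ s, (χ s x - χ s y) ^ 2 ≤ 4 := by
  have e : ∀ s, (χ s x - χ s y) ^ 2 ≤ 2 * χ s x ^ 2 + 2 * χ s y ^ 2 := fun s => by
    nlinarith [sq_nonneg (χ s x + χ s y)]
  calc ∑ s, (χ s x - χ s y) ^ 2 ≤ ∑ s, (2 * χ s x ^ 2 + 2 * χ s y ^ 2) := Finset.sum_le_sum fun s _ => e s
    _ = 4 := by
      rw [Finset.sum_add_distrib, ← Finset.mul_sum, ← Finset.mul_sum, hpart, hpart]
      norm_num

/-- Each `χ_s(x)² ≤ 1`. [cite: LiebYau1988, (3.2)] -/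
theorem partition_sq_le_one (χ : ι → α → ℝ) (hpart : ∀ x, ∑ s, χ s x ^ 2 = 1) (s : ι) (x : α) :
    χ s x ^ 2 ≤ 1 := by
  calc χ s x ^ 2 ≤ ∑ t, χ t x ^ 2 := Finset.single_le_sum (fun t _ => sq_nonneg (χ t x)) (Finset.mem_univ s)
    _ = 1 := hpart x

/-- Each `|χ_s(x)| ≤ 1`. [cite: LiebYau1988, (3.2)] -/
theorem partition_abs_le_one (χ : ι → α → ℝ) (hpart : ∀ x, ∑ s, χ s x ^ 2 = 1) (s : ι) (x : α) :
    |χ s x| ≤ 1 := by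
  rw [abs_le_one_iff_mul_self_le_one, ← pow_two]
  exact partition_sq_le_one χ hpart s x

/-- `|χ_s(x) χ_s(y)| ≤ 1`. [cite: LiebYau1988, (3.2)] -/
theorem partition_abs_mul_le_one (χ : ι → α → ℝ) (hpart : ∀ x, ∑ s, χ s x ^ 2 = 1) (s : ι) (x y : α) :
    |χ s x * χ s y| ≤ 1 := by
  rw [abs_mul]
  calc |χ s x| * |χ s y| ≤ 1 * 1 :=
        mul_le_mul (partition_abs_le_one χ hpart s x) (partition_abs_le_one χ hpart s y) (abs_nonneg _)
          zero_le_one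
    _ = 1 := one_mul 1

/-- The IMS identity at the level of the integrand: for every kernel `K` (no symmetry, no sign needed),
`Σ_s (χ_s f)(x) K(x,y) (χ_s g)(y) = f(x) K(x,y) g(y) − ½ · f(x) · (K(x,y) Σ_s (χ_s(x) − χ_s(y))²) · g(y)`.
[cite: LiebYau1988, Thm 9, (3.6)–(3.7)] -/
theorem sum_localized_integrand (K : α → α → ℝ) (χ : ι → α → ℝ) (hpart : ∀ x, ∑ s, χ s x ^ 2 = 1)
    (f g : α → ℝ) (x y : α) :
    ∑ s, (χ s * f) x * K x y * ((χ s * g) y) =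
      f x * K x y * g y - (1 / 2) * (f x * (K x y * ∑ s, (χ s x - χ s y) ^ 2) * g y) := by
  simp only [Pi.mul_apply]
  have e : ∑ s, χ s x * f x * K x y * (χ s y * g y) = (f x * K x y * g y) * ∑ s, χ s x * χ s y := by
    rw [Finset.mul_sum]
    exact Finset.sum_congr rfl fun s _ => by ring
  rw [e, sum_mul_eq_one_sub_half_sum_sq_sub χ hpart x y]
  ring

/-- The weights `Σ_s m_s χ_s(x)²` of local constants `m_s ≤ M` are `≤ M`. [cite: LiebYau1988, (3.2)] -/
theorem sum_mul_sq_le (χ : ι → α → ℝ) (hpart : ∀ x, ∑ s, χ s x ^ 2 = 1) (m : ι → ℝ) {M : ℝ}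
    (hm : ∀ s, m s ≤ M) (x : α) : ∑ s, m s * χ s x ^ 2 ≤ M := by
  calc ∑ s, m s * χ s x ^ 2 ≤ ∑ s, M * χ s x ^ 2 :=
        Finset.sum_le_sum fun s _ => mul_le_mul_of_nonneg_right (hm s) (sq_nonneg _)
    _ = M := by rw [← Finset.mul_sum, hpart, mul_one]

/-- Dually, `Σ_s e_s χ_s(x)² ≥ e₀` when all `e_s ≥ e₀`. [cite: LiebYau1988, (3.2)] -/
theorem le_sum_mul_sq (χ : ι → α → ℝ) (hpart : ∀ x, ∑ s, χ s x ^ 2 = 1) (e : ι → ℝ) {e₀ : ℝ}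
    (he : ∀ s, e₀ ≤ e s) (x : α) : e₀ ≤ ∑ s, e s * χ s x ^ 2 := by
  calc e₀ = ∑ s, e₀ * χ s x ^ 2 := by rw [← Finset.mul_sum, hpart, mul_one]
    _ ≤ ∑ s, e s * χ s x ^ 2 := Finset.sum_le_sum fun s _ => mul_le_mul_of_nonneg_right (he s) (sq_nonneg _)

end Algebra

/-! ## 2. The kernel IMS formula on a measure space -/

section Measure

variable {X : Type*} [MeasurableSpace X] {μ : Measure X} {ι : Type*} [Fintype ι]

/-- The squared-increment weight `(x,y) ↦ Σ_s (χ_s(x) − χ_s(y))²` is jointly measurable. [cite: LiebYau1988, (3.7)] -/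
theorem measurable_sum_sq_sub (χ : ι → X → ℝ) (hχ : ∀ s, Measurable (χ s)) :
    Measurable fun p : X × X => ∑ s, (χ s p.1 - χ s p.2) ^ 2 :=
  Finset.measurable_sum _ fun s _ =>
    (((hχ s).comp measurable_fst).sub ((hχ s).comp measurable_snd)).pow_const 2

/-- Each localised integrand `(χ_s f)(x) K(x,y) (χ_s g)(y)` is integrable on `μ ⊗ μ` as soon as `f(x) K(x,y) g(y)`
is (it is dominated by it, `|χ_s| ≤ 1`). [cite: LiebYau1988, Thm 9] -/
theorem integrable_localized (K : X → X → ℝ) (χ : ι → X → ℝ) (hpart : ∀ x, ∑ s, χ s x ^ 2 = 1)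
    (hχ : ∀ s, Measurable (χ s)) (f g : X → ℝ)
    (hI : Integrable (fun p : X × X => f p.1 * K p.1 p.2 * g p.2) (μ.prod μ)) (s : ι) :
    Integrable (fun p : X × X => (χ s * f) p.1 * K p.1 p.2 * ((χ s * g) p.2)) (μ.prod μ) := by
  have hm : AEStronglyMeasurable
      (fun p : X × X => (χ s p.1 * χ s p.2) * (f p.1 * K p.1 p.2 * g p.2)) (μ.prod μ) :=
    (((hχ s).comp measurable_fst).mul ((hχ s).comp measurable_snd)).aestronglyMeasurable.mul
      hI.aestronglyMeasurable
  have h : Integrable (fun p : X × X => (χ s p.1 * χ s p.2) * (f p.1 * K p.1 p.2 * g p.2)) (μ.prod μ) := by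
    refine hI.norm.mono' hm (ae_of_all _ fun p => ?_)
    rw [norm_mul, Real.norm_eq_abs]
    exact mul_le_of_le_one_left (norm_nonneg _) (partition_abs_mul_le_one χ hpart s p.1 p.2)
  refine h.congr (ae_of_all _ fun p => ?_)
  simp only [Pi.mul_apply]
  ring

/-- The localisation-error integrand `f(x) · K(x,y) Σ_s (χ_s(x) − χ_s(y))² · g(y)` is integrable on `μ ⊗ μ` as soon
as `f(x) K(x,y) g(y)` is (the weight is `≤ 4`). [cite: LiebYau1988, Thm 9, (3.7)] -/
theorem integrable_imsError (K : X → X → ℝ) (χ : ι → X → ℝ) (hpart : ∀ x, ∑ s, χ s x ^ 2 = 1)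
    (hχ : ∀ s, Measurable (χ s)) (f g : X → ℝ)
    (hI : Integrable (fun p : X × X => f p.1 * K p.1 p.2 * g p.2) (μ.prod μ)) :
    Integrable (fun p : X × X => f p.1 * (K p.1 p.2 * ∑ s, (χ s p.1 - χ s p.2) ^ 2) * g p.2) (μ.prod μ) := by
  have hm : AEStronglyMeasurable
      (fun p : X × X => (∑ s, (χ s p.1 - χ s p.2) ^ 2) * (f p.1 * K p.1 p.2 * g p.2)) (μ.prod μ) :=
    (measurable_sum_sq_sub χ hχ).aestronglyMeasurable.mul hI.aestronglyMeasurable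
  have h : Integrable (fun p : X × X => (∑ s, (χ s p.1 - χ s p.2) ^ 2) * (f p.1 * K p.1 p.2 * g p.2))
      (μ.prod μ) := by
    refine (hI.norm.const_mul 4).mono' hm (ae_of_all _ fun p => ?_)
    rw [norm_mul, Real.norm_eq_abs, abs_of_nonneg (sum_sq_sub_nonneg χ p.1 p.2)]
    exact mul_le_mul_of_nonneg_right (sum_sq_sub_le_four χ hpart p.1 p.2) (norm_nonneg _)
  refine h.congr (ae_of_all _ fun p => ?_)
  ring

/-- Each `(χ_s f)²` is integrable when `f²` is. [cite: LiebYau1988, (3.2)] -/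
theorem integrable_localized_sq (χ : ι → X → ℝ) (hpart : ∀ x, ∑ s, χ s x ^ 2 = 1)
    (hχ : ∀ s, Measurable (χ s)) (f : X → ℝ) (hf : Integrable (fun x => f x ^ 2) μ) (s : ι) :
    Integrable (fun x => ((χ s * f) x) ^ 2) μ := by
  have hm : AEStronglyMeasurable (fun x => χ s x ^ 2 * f x ^ 2) μ :=
    ((hχ s).pow_const 2).aestronglyMeasurable.mul hf.aestronglyMeasurable
  have h : Integrable (fun x => χ s x ^ 2 * f x ^ 2) μ := by
    refine hf.norm.mono' hm (ae_of_all _ fun x => ?_)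
    rw [norm_mul, Real.norm_eq_abs, abs_of_nonneg (sq_nonneg (χ s x))]
    exact mul_le_of_le_one_left (norm_nonneg _) (partition_sq_le_one χ hpart s x)
  refine h.congr (ae_of_all _ fun x => ?_)
  simp only [Pi.mul_apply]
  ring

/-- The partition preserves the `L²` norm: `Σ_s ∫ (χ_s f)² dμ = ∫ f² dμ`. [cite: LiebYau1988, (3.2)] -/
theorem sum_integral_localized_sq (χ : ι → X → ℝ) (hpart : ∀ x, ∑ s, χ s x ^ 2 = 1)
    (hχ : ∀ s, Measurable (χ s)) (f : X → ℝ) (hf : Integrable (fun x => f x ^ 2) μ) :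
    ∑ s, ∫ x, ((χ s * f) x) ^ 2 ∂μ = ∫ x, f x ^ 2 ∂μ := by
  rw [← integral_finsetSum _ fun s _ => integrable_localized_sq χ hpart hχ f hf s]
  refine integral_congr_ae (ae_of_all _ fun x => ?_)
  simp only [Pi.mul_apply]
  have e : ∑ s, (χ s x * f x) ^ 2 = f x ^ 2 * ∑ s, χ s x ^ 2 := by
    rw [Finset.mul_sum]
    exact Finset.sum_congr rfl fun s _ => by ring
  rw [e, hpart, mul_one]

/-- Weighted version: `Σ_s m_s ∫ (χ_s f)² = ∫ (Σ_s m_s χ_s²) f²`. [cite: LiebYau1988, (3.2)] -/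
theorem sum_mul_integral_localized_sq (χ : ι → X → ℝ) (hpart : ∀ x, ∑ s, χ s x ^ 2 = 1)
    (hχ : ∀ s, Measurable (χ s)) (f : X → ℝ) (hf : Integrable (fun x => f x ^ 2) μ) (m : ι → ℝ) :
    ∑ s, m s * ∫ x, ((χ s * f) x) ^ 2 ∂μ = ∫ x, (∑ s, m s * χ s x ^ 2) * f x ^ 2 ∂μ := by
  have hLs := integrable_localized_sq (μ := μ) χ hpart hχ f hf
  calc ∑ s, m s * ∫ x, ((χ s * f) x) ^ 2 ∂μ = ∑ s, ∫ x, m s * ((χ s * f) x) ^ 2 ∂μ :=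
        Finset.sum_congr rfl fun s _ => (integral_const_mul _ _).symm
    _ = ∫ x, ∑ s, m s * ((χ s * f) x) ^ 2 ∂μ := (integral_finsetSum _ fun s _ => (hLs s).const_mul _).symm
    _ = ∫ x, (∑ s, m s * χ s x ^ 2) * f x ^ 2 ∂μ := by
        refine integral_congr_ae (ae_of_all _ fun x => ?_)
        simp only [Pi.mul_apply]
        rw [Finset.sum_mul]
        exact Finset.sum_congr rfl fun s _ => by ring

/-- The weighted square `(Σ_s m_s χ_s²) f²` is integrable when `f²` is. [cite: LiebYau1988, (3.2)] -/
theorem integrable_sum_mul_sq_mul_sq (χ : ι → X → ℝ) (hpart : ∀ x, ∑ s, χ s x ^ 2 = 1)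
    (hχ : ∀ s, Measurable (χ s)) (f : X → ℝ) (hf : Integrable (fun x => f x ^ 2) μ) (m : ι → ℝ) :
    Integrable (fun x => (∑ s, m s * χ s x ^ 2) * f x ^ 2) μ := by
  have e : (fun x => (∑ s, m s * χ s x ^ 2) * f x ^ 2) = fun x => ∑ s, m s * ((χ s * f) x) ^ 2 := by
    funext x
    simp only [Pi.mul_apply]
    rw [Finset.sum_mul]
    exact Finset.sum_congr rfl fun s _ => by ring
  rw [e]
  exact integrable_finsetSum _ fun s _ => (integrable_localized_sq χ hpart hχ f hf s).const_mul _

/-- Domination used twice below: `|K(x,y)| Σ_s(…)² · w² ≤ 4 |K(x,y) w²|`, so the error kernel inherits the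
one-sided integrability conditions of `K`. [cite: LiebYau1988, Thm 9, (3.7)] -/
private theorem integrable_absKernel_weight_mul_sq (K : X → X → ℝ) (χ : ι → X → ℝ)
    (hpart : ∀ x, ∑ s, χ s x ^ 2 = 1) (hχ : ∀ s, Measurable (χ s)) (w : X × X → ℝ)
    (hKw : Integrable (fun p : X × X => K p.1 p.2 * w p ^ 2) (μ.prod μ)) :
    Integrable (fun p : X × X => (|K p.1 p.2| * ∑ s, (χ s p.1 - χ s p.2) ^ 2) * |w p| ^ 2) (μ.prod μ) := by
  have hm : AEStronglyMeasurable
      (fun p : X × X => (∑ s, (χ s p.1 - χ s p.2) ^ 2) * ‖K p.1 p.2 * w p ^ 2‖) (μ.prod μ) :=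
    (measurable_sum_sq_sub χ hχ).aestronglyMeasurable.mul hKw.aestronglyMeasurable.norm
  have h : Integrable (fun p : X × X => (∑ s, (χ s p.1 - χ s p.2) ^ 2) * ‖K p.1 p.2 * w p ^ 2‖) (μ.prod μ) := by
    refine (hKw.norm.const_mul 4).mono' hm (ae_of_all _ fun p => ?_)
    rw [norm_mul, Real.norm_eq_abs, abs_of_nonneg (sum_sq_sub_nonneg χ p.1 p.2), norm_norm]
    exact mul_le_mul_of_nonneg_right (sum_sq_sub_le_four χ hpart p.1 p.2) (norm_nonneg _)
  refine h.congr (ae_of_all _ fun p => ?_)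
  simp only [Real.norm_eq_abs, abs_mul, sq_abs, abs_of_nonneg (sq_nonneg (w p))]
  ring

variable [SFinite μ]

/-- **The IMS localisation formula for an integral kernel** (bilinear, iterated-integral form).  For every real kernel
`K` on `(X, μ)`, every finite quadratic partition of unity `Σ_s χ_s² = 1` by measurable functions and all real `f, g`
with `f(x) K(x,y) g(y) ∈ L¹(μ ⊗ μ)`:
`Σ_s ∫∫ (χ_s f)(x) K(x,y) (χ_s g)(y) = ∫∫ f(x) K(x,y) g(y) − ½ ∫∫ f(x) · K(x,y) Σ_s (χ_s(x) − χ_s(y))² · g(y)`.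
Printed for the kernel of `|p|` on `ℝ³` as `(f,|p|f) = Σ_j (χ_j f,|p|χ_j f) − (f, L f)`,
`L(x,y) = (2π²)⁻¹|x−y|⁻⁴ Σ_j [χ_j(x) − χ_j(y)]²` (there the form is `c ∫∫ |f(x) − f(y)|² k`, which flips the sign
of the kernel term); the computation is identical for any kernel. [cite: LiebYau1988, Thm 9, (3.6)–(3.7)] -/
theorem ims_localization (K : X → X → ℝ) (χ : ι → X → ℝ) (hpart : ∀ x, ∑ s, χ s x ^ 2 = 1)
    (hχ : ∀ s, Measurable (χ s)) (f g : X → ℝ)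
    (hI : Integrable (fun p : X × X => f p.1 * K p.1 p.2 * g p.2) (μ.prod μ)) :
    ∑ s, ∫ x, ∫ y, (χ s * f) x * K x y * ((χ s * g) y) ∂μ ∂μ =
      (∫ x, ∫ y, f x * K x y * g y ∂μ ∂μ)
        - (1 / 2) * ∫ x, ∫ y, f x * (K x y * ∑ s, (χ s x - χ s y) ^ 2) * g y ∂μ ∂μ := by
  have hL := integrable_localized (μ := μ) K χ hpart hχ f g hI
  have hE := integrable_imsError (μ := μ) K χ hpart hχ f g hI
  -- pass to the product measure
  have e1 : ∑ s, ∫ x, ∫ y, (χ s * f) x * K x y * ((χ s * g) y) ∂μ ∂μ =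
      ∑ s, ∫ p, (χ s * f) p.1 * K p.1 p.2 * ((χ s * g) p.2) ∂(μ.prod μ) :=
    Finset.sum_congr rfl fun s _ => (integral_prod _ (hL s)).symm
  have e2 : ∫ x, ∫ y, f x * K x y * g y ∂μ ∂μ = ∫ p, f p.1 * K p.1 p.2 * g p.2 ∂(μ.prod μ) :=
    (integral_prod _ hI).symm
  have e3 : ∫ x, ∫ y, f x * (K x y * ∑ s, (χ s x - χ s y) ^ 2) * g y ∂μ ∂μ =
      ∫ p, f p.1 * (K p.1 p.2 * ∑ s, (χ s p.1 - χ s p.2) ^ 2) * g p.2 ∂(μ.prod μ) :=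
    (integral_prod _ hE).symm
  rw [e1, e2, e3]
  calc ∑ s, ∫ p, (χ s * f) p.1 * K p.1 p.2 * ((χ s * g) p.2) ∂(μ.prod μ)
      = ∫ p, ∑ s, (χ s * f) p.1 * K p.1 p.2 * ((χ s * g) p.2) ∂(μ.prod μ) :=
        (integral_finsetSum _ fun s _ => hL s).symm
    _ = ∫ p, (f p.1 * K p.1 p.2 * g p.2
          - (1 / 2) * (f p.1 * (K p.1 p.2 * ∑ s, (χ s p.1 - χ s p.2) ^ 2) * g p.2)) ∂(μ.prod μ) :=
        integral_congr_ae (ae_of_all _ fun p => sum_localized_integrand K χ hpart f g p.1 p.2)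
    _ = (∫ p, f p.1 * K p.1 p.2 * g p.2 ∂(μ.prod μ))
          - (1 / 2) * ∫ p, f p.1 * (K p.1 p.2 * ∑ s, (χ s p.1 - χ s p.2) ^ 2) * g p.2 ∂(μ.prod μ) := by
        rw [integral_sub hI (hE.const_mul _), integral_const_mul]

/-- **Schur bound on the localisation error.**  If the error kernel `|K(x,y)| · Σ_s (χ_s(x) − χ_s(y))²` has a.e. row
integrals `≤ ε` and a.e. column integrals `≤ ε`, then `|∫∫ f(x) · K(x,y) Σ_s(χ_s(x) − χ_s(y))² · f(y)| ≤ ε ∫ f²`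
(Schur's test, `SchurTest.integral_integral_mul_kernel_mul_self_le`, applied to the error kernel and `|f|`).  This is how
the printed `L` is shown to be bounded, and how a lower bound proved piece by piece is paid for.  Integrability side
conditions as in `SchurTestKernel`. [cite: LiebYau1988, Thm 9–10, (3.7), (3.13)–(3.17)] -/
theorem abs_integral_imsError_le (K : X → X → ℝ) (χ : ι → X → ℝ) (hpart : ∀ x, ∑ s, χ s x ^ 2 = 1)
    (hχ : ∀ s, Measurable (χ s)) (f : X → ℝ) {ε : ℝ}
    (hrow : ∀ᵐ x ∂μ, ∫ y, |K x y| * ∑ s, (χ s x - χ s y) ^ 2 ∂μ ≤ ε)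
    (hcol : ∀ᵐ y ∂μ, ∫ x, |K x y| * ∑ s, (χ s x - χ s y) ^ 2 ∂μ ≤ ε)
    (hf : Integrable (fun x => f x ^ 2) μ)
    (hI : Integrable (fun p : X × X => f p.1 * K p.1 p.2 * f p.2) (μ.prod μ))
    (hI₁ : Integrable (fun p : X × X => K p.1 p.2 * f p.1 ^ 2) (μ.prod μ))
    (hI₂ : Integrable (fun p : X × X => K p.1 p.2 * f p.2 ^ 2) (μ.prod μ)) :
    |∫ x, ∫ y, f x * (K x y * ∑ s, (χ s x - χ s y) ^ 2) * f y ∂μ ∂μ| ≤ ε * ∫ x, f x ^ 2 ∂μ := by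
  have hE := integrable_imsError (μ := μ) K χ hpart hχ f f hI
  have hS0 : ∀ x y : X, 0 ≤ ∑ s, (χ s x - χ s y) ^ 2 := fun x y => sum_sq_sub_nonneg χ x y
  -- the hypotheses of Schur's test for the error kernel and `|f|`
  have hK : ∀ x y : X, 0 ≤ |K x y| * ∑ s, (χ s x - χ s y) ^ 2 :=
    fun x y => mul_nonneg (abs_nonneg _) (hS0 x y)
  have hψ : Integrable (fun x => |f x| ^ 2) μ := hf.congr (ae_of_all _ fun x => (sq_abs (f x)).symm)
  have hI' : Integrable
      (fun p : X × X => |f p.1| * (|K p.1 p.2| * ∑ s, (χ s p.1 - χ s p.2) ^ 2) * |f p.2|) (μ.prod μ) := by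
    refine hE.abs.congr (ae_of_all _ fun p => ?_)
    simp only [abs_mul, abs_of_nonneg (hS0 p.1 p.2)]
  have hI₁' := integrable_absKernel_weight_mul_sq (μ := μ) K χ hpart hχ (fun p => f p.1) hI₁
  have hI₂' := integrable_absKernel_weight_mul_sq (μ := μ) K χ hpart hχ (fun p => f p.2) hI₂
  have key := SchurTest.integral_integral_mul_kernel_mul_self_le (μ := μ)
    (fun x y => |K x y| * ∑ s, (χ s x - χ s y) ^ 2) (fun x => |f x|) hK hrow hcol hψ hI' hI₁' hI₂'
  have eψ : ∫ x, |f x| ^ 2 ∂μ = ∫ x, f x ^ 2 ∂μ := integral_congr_ae (ae_of_all _ fun x => sq_abs (f x))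
  -- |∫∫ F| ≤ ∫ |∫ F| ≤ ∫∫ |F| = ∫∫ |f| E |f| ≤ ε ∫ |f|² = ε ∫ f²
  have h1 : Integrable (fun x => |∫ y, f x * (K x y * ∑ s, (χ s x - χ s y) ^ 2) * f y ∂μ|) μ :=
    hE.integral_prod_left.abs
  have h2 : Integrable (fun x => ∫ y, |f x * (K x y * ∑ s, (χ s x - χ s y) ^ 2) * f y| ∂μ) μ :=
    hE.abs.integral_prod_left
  calc |∫ x, ∫ y, f x * (K x y * ∑ s, (χ s x - χ s y) ^ 2) * f y ∂μ ∂μ|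
      ≤ ∫ x, |∫ y, f x * (K x y * ∑ s, (χ s x - χ s y) ^ 2) * f y ∂μ| ∂μ := abs_integral_le_integral_abs
    _ ≤ ∫ x, ∫ y, |f x * (K x y * ∑ s, (χ s x - χ s y) ^ 2) * f y| ∂μ ∂μ :=
        integral_mono h1 h2 fun x => abs_integral_le_integral_abs
    _ = ∫ x, ∫ y, |f x| * (|K x y| * ∑ s, (χ s x - χ s y) ^ 2) * |f y| ∂μ ∂μ := by
        refine integral_congr_ae (ae_of_all _ fun x => ?_)
        refine integral_congr_ae (ae_of_all _ fun y => ?_)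
        simp only [abs_mul, abs_of_nonneg (hS0 x y)]
    _ ≤ ε * ∫ x, |f x| ^ 2 ∂μ := key
    _ = ε * ∫ x, f x ^ 2 ∂μ := by rw [eψ]

/-- **IMS, two-sided form**: `|∫∫ f K f − Σ_s ∫∫ (χ_s f) K (χ_s f)| ≤ (ε/2) ∫ f²` under the Schur bounds `ε` on the
error kernel `|K(x,y)| Σ_s (χ_s(x) − χ_s(y))²`. [cite: LiebYau1988, Thm 9–10, (3.6)–(3.7)] -/
theorem abs_sub_sum_localized_le (K : X → X → ℝ) (χ : ι → X → ℝ) (hpart : ∀ x, ∑ s, χ s x ^ 2 = 1)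
    (hχ : ∀ s, Measurable (χ s)) (f : X → ℝ) {ε : ℝ}
    (hrow : ∀ᵐ x ∂μ, ∫ y, |K x y| * ∑ s, (χ s x - χ s y) ^ 2 ∂μ ≤ ε)
    (hcol : ∀ᵐ y ∂μ, ∫ x, |K x y| * ∑ s, (χ s x - χ s y) ^ 2 ∂μ ≤ ε)
    (hf : Integrable (fun x => f x ^ 2) μ)
    (hI : Integrable (fun p : X × X => f p.1 * K p.1 p.2 * f p.2) (μ.prod μ))
    (hI₁ : Integrable (fun p : X × X => K p.1 p.2 * f p.1 ^ 2) (μ.prod μ))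
    (hI₂ : Integrable (fun p : X × X => K p.1 p.2 * f p.2 ^ 2) (μ.prod μ)) :
    |(∫ x, ∫ y, f x * K x y * f y ∂μ ∂μ) - ∑ s, ∫ x, ∫ y, (χ s * f) x * K x y * ((χ s * f) y) ∂μ ∂μ|
      ≤ ε / 2 * ∫ x, f x ^ 2 ∂μ := by
  rw [ims_localization K χ hpart hχ f f hI, sub_sub_cancel, abs_mul, abs_of_pos (by norm_num : (0:ℝ) < 1 / 2)]
  have := abs_integral_imsError_le K χ hpart hχ f hrow hcol hf hI hI₁ hI₂
  linarith

/-- **Transfer of local bounds (transfer-operator form).**  If each localised form is bounded by a local constant,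
`∫∫ (χ_s f) K (χ_s f) ≤ m_s ∫ (χ_s f)²`, then `∫∫ f K f ≤ ∫ (Σ_s m_s χ_s²) f² + (ε/2) ∫ f²` — the kernel analogue of
bounding `H` below by the "effective potential" `Σ_s E_s J_s²` up to the localisation error.
[cite: LiebYau1988, Thm 9–10, (3.6), (3.17)] -/
theorem le_of_localized_le (K : X → X → ℝ) (χ : ι → X → ℝ) (hpart : ∀ x, ∑ s, χ s x ^ 2 = 1)
    (hχ : ∀ s, Measurable (χ s)) (f : X → ℝ) {ε : ℝ} (m : ι → ℝ)
    (hrow : ∀ᵐ x ∂μ, ∫ y, |K x y| * ∑ s, (χ s x - χ s y) ^ 2 ∂μ ≤ ε)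
    (hcol : ∀ᵐ y ∂μ, ∫ x, |K x y| * ∑ s, (χ s x - χ s y) ^ 2 ∂μ ≤ ε)
    (hf : Integrable (fun x => f x ^ 2) μ)
    (hI : Integrable (fun p : X × X => f p.1 * K p.1 p.2 * f p.2) (μ.prod μ))
    (hI₁ : Integrable (fun p : X × X => K p.1 p.2 * f p.1 ^ 2) (μ.prod μ))
    (hI₂ : Integrable (fun p : X × X => K p.1 p.2 * f p.2 ^ 2) (μ.prod μ))
    (hloc : ∀ s, ∫ x, ∫ y, (χ s * f) x * K x y * ((χ s * f) y) ∂μ ∂μ ≤ m s * ∫ x, ((χ s * f) x) ^ 2 ∂μ) :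
    ∫ x, ∫ y, f x * K x y * f y ∂μ ∂μ ≤
      (∫ x, (∑ s, m s * χ s x ^ 2) * f x ^ 2 ∂μ) + ε / 2 * ∫ x, f x ^ 2 ∂μ := by
  have h1 := abs_sub_sum_localized_le K χ hpart hχ f hrow hcol hf hI hI₁ hI₂
  have h2 : ∑ s, ∫ x, ∫ y, (χ s * f) x * K x y * ((χ s * f) y) ∂μ ∂μ ≤ ∑ s, m s * ∫ x, ((χ s * f) x) ^ 2 ∂μ :=
    Finset.sum_le_sum fun s _ => hloc s
  rw [sum_mul_integral_localized_sq χ hpart hχ f hf m] at h2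
  have h3 := (abs_le.mp h1).2
  linarith

/-- Crude form: local constants `m_s ≤ M` give the global bound `∫∫ f K f ≤ (M + ε/2) ∫ f²` (the Rayleigh quotient of
the kernel is at most `M + ε/2`). [cite: LiebYau1988, Thm 9–10, (3.6), (3.17)] -/
theorem le_const_mul_of_localized_le (K : X → X → ℝ) (χ : ι → X → ℝ) (hpart : ∀ x, ∑ s, χ s x ^ 2 = 1)
    (hχ : ∀ s, Measurable (χ s)) (f : X → ℝ) {ε M : ℝ} (m : ι → ℝ) (hm : ∀ s, m s ≤ M)
    (hrow : ∀ᵐ x ∂μ, ∫ y, |K x y| * ∑ s, (χ s x - χ s y) ^ 2 ∂μ ≤ ε)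
    (hcol : ∀ᵐ y ∂μ, ∫ x, |K x y| * ∑ s, (χ s x - χ s y) ^ 2 ∂μ ≤ ε)
    (hf : Integrable (fun x => f x ^ 2) μ)
    (hI : Integrable (fun p : X × X => f p.1 * K p.1 p.2 * f p.2) (μ.prod μ))
    (hI₁ : Integrable (fun p : X × X => K p.1 p.2 * f p.1 ^ 2) (μ.prod μ))
    (hI₂ : Integrable (fun p : X × X => K p.1 p.2 * f p.2 ^ 2) (μ.prod μ))
    (hloc : ∀ s, ∫ x, ∫ y, (χ s * f) x * K x y * ((χ s * f) y) ∂μ ∂μ ≤ m s * ∫ x, ((χ s * f) x) ^ 2 ∂μ) :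
    ∫ x, ∫ y, f x * K x y * f y ∂μ ∂μ ≤ (M + ε / 2) * ∫ x, f x ^ 2 ∂μ := by
  have h1 := le_of_localized_le K χ hpart hχ f m hrow hcol hf hI hI₁ hI₂ hloc
  have h2 : ∫ x, (∑ s, m s * χ s x ^ 2) * f x ^ 2 ∂μ ≤ ∫ x, M * f x ^ 2 ∂μ :=
    integral_mono (integrable_sum_mul_sq_mul_sq χ hpart hχ f hf m) (hf.const_mul M) fun x =>
      mul_le_mul_of_nonneg_right (sum_mul_sq_le χ hpart m hm x) (sq_nonneg _)
  rw [integral_const_mul] at h2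
  linarith

/-- **IMS lower bound (energy form).**  For the energy-type form `𝔮(f) = c ∫ f² − ∫∫ f K f` (e.g. `c − K` with `K` a
transfer kernel, or `t⁻¹(1 − e^{−tH})` as in the printed derivation of `(f,|p|f)`): local lower bounds
`𝔮(χ_s f) ≥ e_s ∫ (χ_s f)²` transfer to `𝔮(f) ≥ ∫ (Σ_s e_s χ_s²) f² − (ε/2) ∫ f²`, `ε` the Schur bound of the error
kernel — the measure-space twin of the tree's matrix lemma `B9SectEKernel.ims_lower`.
[cite: LiebYau1988, Thm 9–10, (3.6)–(3.7), (3.17)] -/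
theorem ims_lower (K : X → X → ℝ) (χ : ι → X → ℝ) (hpart : ∀ x, ∑ s, χ s x ^ 2 = 1)
    (hχ : ∀ s, Measurable (χ s)) (f : X → ℝ) {ε : ℝ} (c : ℝ) (e : ι → ℝ)
    (hrow : ∀ᵐ x ∂μ, ∫ y, |K x y| * ∑ s, (χ s x - χ s y) ^ 2 ∂μ ≤ ε)
    (hcol : ∀ᵐ y ∂μ, ∫ x, |K x y| * ∑ s, (χ s x - χ s y) ^ 2 ∂μ ≤ ε)
    (hf : Integrable (fun x => f x ^ 2) μ)
    (hI : Integrable (fun p : X × X => f p.1 * K p.1 p.2 * f p.2) (μ.prod μ))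
    (hI₁ : Integrable (fun p : X × X => K p.1 p.2 * f p.1 ^ 2) (μ.prod μ))
    (hI₂ : Integrable (fun p : X × X => K p.1 p.2 * f p.2 ^ 2) (μ.prod μ))
    (hloc : ∀ s, e s * ∫ x, ((χ s * f) x) ^ 2 ∂μ ≤
      c * ∫ x, ((χ s * f) x) ^ 2 ∂μ - ∫ x, ∫ y, (χ s * f) x * K x y * ((χ s * f) y) ∂μ ∂μ) :
    (∫ x, (∑ s, e s * χ s x ^ 2) * f x ^ 2 ∂μ) - ε / 2 * ∫ x, f x ^ 2 ∂μ ≤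
      c * (∫ x, f x ^ 2 ∂μ) - ∫ x, ∫ y, f x * K x y * f y ∂μ ∂μ := by
  have hloc' : ∀ s, ∫ x, ∫ y, (χ s * f) x * K x y * ((χ s * f) y) ∂μ ∂μ ≤
      (c - e s) * ∫ x, ((χ s * f) x) ^ 2 ∂μ := fun s => by
    have := hloc s
    rw [sub_mul]
    linarith
  have h1 := le_of_localized_le K χ hpart hχ f (fun s => c - e s) hrow hcol hf hI hI₁ hI₂ hloc'
  have e1 : ∫ x, (∑ s, (c - e s) * χ s x ^ 2) * f x ^ 2 ∂μ =
      c * (∫ x, f x ^ 2 ∂μ) - ∫ x, (∑ s, e s * χ s x ^ 2) * f x ^ 2 ∂μ := by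
    rw [← sum_mul_integral_localized_sq χ hpart hχ f hf, ← sum_mul_integral_localized_sq χ hpart hχ f hf,
      ← sum_integral_localized_sq χ hpart hχ f hf, Finset.mul_sum, ← Finset.sum_sub_distrib]
    exact Finset.sum_congr rfl fun s _ => by ring
  rw [e1] at h1
  linarith

/-- Crude energy form: local gaps `e_s ≥ e₀` everywhere give `c ∫f² − ∫∫ fKf ≥ (e₀ − ε/2) ∫ f²`.
[cite: LiebYau1988, Thm 9–10, (3.6)–(3.7), (3.17)] -/
theorem ims_lower_const (K : X → X → ℝ) (χ : ι → X → ℝ) (hpart : ∀ x, ∑ s, χ s x ^ 2 = 1)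
    (hχ : ∀ s, Measurable (χ s)) (f : X → ℝ) {ε e₀ : ℝ} (c : ℝ) (e : ι → ℝ) (he : ∀ s, e₀ ≤ e s)
    (hrow : ∀ᵐ x ∂μ, ∫ y, |K x y| * ∑ s, (χ s x - χ s y) ^ 2 ∂μ ≤ ε)
    (hcol : ∀ᵐ y ∂μ, ∫ x, |K x y| * ∑ s, (χ s x - χ s y) ^ 2 ∂μ ≤ ε)
    (hf : Integrable (fun x => f x ^ 2) μ)
    (hI : Integrable (fun p : X × X => f p.1 * K p.1 p.2 * f p.2) (μ.prod μ))
    (hI₁ : Integrable (fun p : X × X => K p.1 p.2 * f p.1 ^ 2) (μ.prod μ))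
    (hI₂ : Integrable (fun p : X × X => K p.1 p.2 * f p.2 ^ 2) (μ.prod μ))
    (hloc : ∀ s, e s * ∫ x, ((χ s * f) x) ^ 2 ∂μ ≤
      c * ∫ x, ((χ s * f) x) ^ 2 ∂μ - ∫ x, ∫ y, (χ s * f) x * K x y * ((χ s * f) y) ∂μ ∂μ) :
    (e₀ - ε / 2) * ∫ x, f x ^ 2 ∂μ ≤ c * (∫ x, f x ^ 2 ∂μ) - ∫ x, ∫ y, f x * K x y * f y ∂μ ∂μ := by
  have h1 := ims_lower K χ hpart hχ f c e hrow hcol hf hI hI₁ hI₂ hloc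
  have h2 : ∫ x, e₀ * f x ^ 2 ∂μ ≤ ∫ x, (∑ s, e s * χ s x ^ 2) * f x ^ 2 ∂μ :=
    integral_mono (hf.const_mul e₀) (integrable_sum_mul_sq_mul_sq χ hpart hχ f hf e) fun x =>
      mul_le_mul_of_nonneg_right (le_sum_mul_sq χ hpart e he x) (sq_nonneg _)
  rw [integral_const_mul] at h2
  rw [sub_mul]
  linarith

/-- **The jump-Dirichlet-form identity for a symmetric transfer kernel.**  If `K(x,y) = K(y,x)` and the row
integrals are constant, `∫ K(x,y) dμ(y) = c` for a.e. `x`, then for real `f` (with `f(x)K(x,y)f(y)` and `K(x,y)f(x)²`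
integrable on `μ ⊗ μ`):  `c ∫ f² − ∫∫ f(x) K(x,y) f(y) = ½ ∫∫ K(x,y) (f(x) − f(y))²`.
This is the computation "inserting (2.11) in (2.10) yields (2.9)" of the source (there `K = ` the kernel of
`e^{−t|p|}`, `c = 1`), valid for any symmetric Markov-type kernel. [cite: LiebYau1988, (2.9)–(2.11)] -/
theorem const_mul_integral_sq_sub_eq_half (K : X → X → ℝ) (f : X → ℝ) {c : ℝ}
    (hsymm : ∀ x y, K x y = K y x) (hrow : ∀ᵐ x ∂μ, ∫ y, K x y ∂μ = c)
    (hI : Integrable (fun p : X × X => f p.1 * K p.1 p.2 * f p.2) (μ.prod μ))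
    (hI₁ : Integrable (fun p : X × X => K p.1 p.2 * f p.1 ^ 2) (μ.prod μ)) :
    c * (∫ x, f x ^ 2 ∂μ) - ∫ x, ∫ y, f x * K x y * f y ∂μ ∂μ =
      (1 / 2 : ℝ) * ∫ x, ∫ y, K x y * (f x - f y) ^ 2 ∂μ ∂μ := by
  -- the mirrored term `K(x,y) f(y)²` is integrable by symmetry
  have hI₂ : Integrable (fun p : X × X => K p.1 p.2 * f p.2 ^ 2) (μ.prod μ) := by
    have h := hI₁.swap
    refine h.congr (ae_of_all _ fun p => ?_)
    simp only [Function.comp, Prod.fst_swap, Prod.snd_swap, hsymm p.2 p.1]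
  -- the three product integrals
  have e1 : ∫ p, K p.1 p.2 * f p.1 ^ 2 ∂(μ.prod μ) = c * ∫ x, f x ^ 2 ∂μ := by
    rw [integral_prod _ hI₁]
    have h : ∀ᵐ x ∂μ, ∫ y, K x y * f x ^ 2 ∂μ = c * f x ^ 2 := by
      filter_upwards [hrow] with x hx
      rw [integral_mul_const, hx]
    rw [integral_congr_ae h, integral_const_mul]
  have e2 : ∫ p, K p.1 p.2 * f p.2 ^ 2 ∂(μ.prod μ) = c * ∫ x, f x ^ 2 ∂μ := by
    rw [← e1, ← integral_prod_swap]
    refine integral_congr_ae (ae_of_all _ fun p => ?_)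
    simp only [Prod.fst_swap, Prod.snd_swap, hsymm p.2 p.1]
  have e3 : ∫ x, ∫ y, f x * K x y * f y ∂μ ∂μ = ∫ p, f p.1 * K p.1 p.2 * f p.2 ∂(μ.prod μ) :=
    (integral_prod _ hI).symm
  -- the Dirichlet integrand, on the product
  have hI12 : Integrable (fun p : X × X => K p.1 p.2 * f p.1 ^ 2 + K p.1 p.2 * f p.2 ^ 2) (μ.prod μ) :=
    hI₁.add hI₂
  have hI3 : Integrable (fun p : X × X => 2 * (f p.1 * K p.1 p.2 * f p.2)) (μ.prod μ) := hI.const_mul 2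
  have hD : Integrable (fun p : X × X => K p.1 p.2 * (f p.1 - f p.2) ^ 2) (μ.prod μ) := by
    refine (hI12.sub hI3).congr (ae_of_all _ fun p => ?_)
    show (K p.1 p.2 * f p.1 ^ 2 + K p.1 p.2 * f p.2 ^ 2) - 2 * (f p.1 * K p.1 p.2 * f p.2) =
      K p.1 p.2 * (f p.1 - f p.2) ^ 2
    ring
  have e4 : ∫ x, ∫ y, K x y * (f x - f y) ^ 2 ∂μ ∂μ = ∫ p, K p.1 p.2 * (f p.1 - f p.2) ^ 2 ∂(μ.prod μ) :=
    (integral_prod _ hD).symm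
  have e5 : ∫ p, K p.1 p.2 * (f p.1 - f p.2) ^ 2 ∂(μ.prod μ) =
      (∫ p, K p.1 p.2 * f p.1 ^ 2 ∂(μ.prod μ)) + (∫ p, K p.1 p.2 * f p.2 ^ 2 ∂(μ.prod μ))
        - 2 * ∫ p, f p.1 * K p.1 p.2 * f p.2 ∂(μ.prod μ) := by
    have h1 : ∫ p, K p.1 p.2 * (f p.1 - f p.2) ^ 2 ∂(μ.prod μ) =
        ∫ p, ((K p.1 p.2 * f p.1 ^ 2 + K p.1 p.2 * f p.2 ^ 2) - 2 * (f p.1 * K p.1 p.2 * f p.2)) ∂(μ.prod μ) :=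
      integral_congr_ae (ae_of_all _ fun p => by ring)
    rw [h1, integral_sub hI12 hI3, integral_add hI₁ hI₂, integral_const_mul]
  rw [e3, e4, e5, e1, e2]
  ring

/-- Consequently, for such kernels a LOWER bound on the transfer form is an UPPER bound on the jump Dirichlet form:
`∫∫ f K f ≥ (c − e) ∫ f²` iff `½ ∫∫ K (f(x) − f(y))² ≤ e ∫ f²`. [cite: LiebYau1988, (2.9)–(2.11)] -/
theorem le_integral_kernel_iff_dirichlet_le (K : X → X → ℝ) (f : X → ℝ) {c e : ℝ}
    (hsymm : ∀ x y, K x y = K y x) (hrow : ∀ᵐ x ∂μ, ∫ y, K x y ∂μ = c)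
    (hI : Integrable (fun p : X × X => f p.1 * K p.1 p.2 * f p.2) (μ.prod μ))
    (hI₁ : Integrable (fun p : X × X => K p.1 p.2 * f p.1 ^ 2) (μ.prod μ)) :
    (c - e) * (∫ x, f x ^ 2 ∂μ) ≤ ∫ x, ∫ y, f x * K x y * f y ∂μ ∂μ ↔
      (1 / 2 : ℝ) * ∫ x, ∫ y, K x y * (f x - f y) ^ 2 ∂μ ∂μ ≤ e * ∫ x, f x ^ 2 ∂μ := by
  rw [← const_mul_integral_sq_sub_eq_half K f hsymm hrow hI hI₁]
  constructor <;> intro h <;> linarith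

end Measure

end Literature.Analysis.OperatorTheory.KernelIMS
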